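import Summits.CriticalPhenomena.PercolationContinuityZ3.Theorems.PercNearOneGluingNoHeavyLowerTailAPLVwThreeLoad
import HarnessLib

/-!
# `NoHeavyLowerTail` (stmt-CriticalPhenomena-4575) — three-load (V_w): the per-pair hypothesis (♣) FOLLOWS FROM APL-G
# (pure real algebra; no calculus, no certificate)

Support file (prover prim-ineq-gen-8 gen 52; `--supports stmt-CriticalPhenomena-4575`; memo
run/shared/lean/prim/prim-ineq-gen-8/FINDING-gen51-TWOLOAD.md §6e–§6g, FINDING-gen52-THREELOAD-LEAN.md).  No definitions,
no named facts, no sorries.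

`…APLVwThreeLoad.lean` (gen 51, `threeLoad_vw_of_pairs`) reduced the three-load (V_w) inequality `W ≤ 2|Cov(L,R)|` to the
per-pair hypothesis (♣) `(κ² − κP − 2Pm)(Ã+B̃)² ≤ P²` (`P = p_ap_b`, `κ = τ − P`, `τ = μ(s↔a ∩ s↔b)`, `m = μ(a↔b off C(s))`,
`Ã = p_a/√(1−p_a²)`).  The memo derived (♣) from the apex inequality APL-G — in `(p,τ,m)` coordinates
`((1−p_a−p_b+τ)τ − (p_a+p_b−τ)m)² ≤ (p_a−τ)(p_b−τ)` (`APL.aplG_all`) — by a derivative/monotonicity argument ((B2)) and an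
exact-arithmetic branch-and-bound certificate for a bivariate polynomial ((B1), 30 623 boxes).  THIS FILE proves it by
short real algebra [this work]:
* `threeLoad_phi_le_one`, `threeLoad_B1_scaled` — (B1) at the base point `κ_b = P/(p_a+p_b)` is the polynomial inequality
  `(1+s)r(1−r)(2−s+sr) ≤ 1` on `0 ≤ 4r ≤ 1+s ≤ 3` (two boxes, each a nonnegative bidegree-(3,2) Bernstein expansion found by
  `nlinarith`), via the identity `((sQ+P)(sP+P))² − s²(sA₁−P)(sB₁−P) = P·s⁵·(1 − (1+s)r(1−r)(2−s+sr))`, `rs² = (1+s)P`;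
* `threeLoad_clubRat_of_aplG_le` — APL-G ⟹ `(κ²−κP−2Pm)(p_a+p_b)² ≤ P²(1−p_b²)` for `p_a ≤ p_b`: (B2) WITHOUT calculus —
  the cubic `C(t) = I(t) − S(t)m̃(t)` is increasing on `[κ_b, A₁]` because its divided difference is a Simpson average of
  `2R(t) + t² + 3P² + σP − c₂ ≥ 0`; with `C(κ_b) ≥ I(κ_b) ≥ 0` and `R(κ) ≤ R(κ_b) ≤ I(κ_b)²` one gets
  `(I − Sm)² ≤ R(κ) ≤ C(κ)²`, so `m ≥ m̃(κ)`;
* `threeLoad_AtBt_bound` (`(Ã+B̃)²(1−p_b²) ≤ (p_a+p_b)²`), `threeLoad_club_of_aplG_le`, **`threeLoad_club_of_aplG`** — (♣) in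
  the `Ã, B̃` form of `threeLoad_pair_nonpos`, for either order of `p_a, p_b`.
The percolation assembly (`threeLoad_vw`) is `…APLVwThreeLoadPerc.lean`.
-/

noncomputable section

namespace Summit.CriticalPhenomena.PercolationContinuityZ3.Theorems

namespace APL

/-! ### (B1): the threshold comparison at `κ_b = P/(p_a+p_b)` -/

/-- **B1 in box form.**  For `s ≤ 2`, `0 ≤ r`, `4r ≤ 1+s`: `(1+s)·r(1−r)·(2−s+sr) ≤ 1`.  (With `s = p_a+p_b`,
`r = (1+s)p_ap_b/s²` this is the threshold comparison (B1) of the memo at the base point `κ_b = p_ap_b/(p_a+p_b)`.)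
Proof: two boxes `r ≤ ½` / `½ < r ≤ ¾, 1 ≤ s`, each by its (nonnegative) bidegree-(3,2) Bernstein expansion. [this work] -/
theorem threeLoad_phi_le_one (r s : ℝ) (hr0 : 0 ≤ r) (hr : 4 * r ≤ 1 + s) (hs2 : s ≤ 2) :
    (1 + s) * r * (1 - r) * (2 - s + s * r) ≤ 1 := by
  rcases le_or_gt r (1 / 2) with h | h
  · have hρ : 0 ≤ 1 / 2 - r := by linarith
    have hσ0 : 0 ≤ 1 + s := by linarith
    have hσ : 0 ≤ 2 - s := by linarith
    nlinarith [mul_nonneg (mul_nonneg hr0 hr0) hr0, mul_nonneg (mul_nonneg hr0 hr0) hρ,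
      mul_nonneg (mul_nonneg hr0 hρ) hρ, mul_nonneg (mul_nonneg hρ hρ) hρ,
      mul_nonneg hσ0 hσ0, mul_nonneg hσ0 hσ, mul_nonneg hσ hσ]
  · have hρ0 : 0 ≤ r - 1 / 2 := by linarith
    have hρ : 0 ≤ 3 / 4 - r := by linarith
    have hσ0 : 0 ≤ s - 1 := by linarith
    have hσ : 0 ≤ 2 - s := by linarith
    nlinarith [mul_nonneg (mul_nonneg hρ0 hρ0) hρ0, mul_nonneg (mul_nonneg hρ0 hρ0) hρ,
      mul_nonneg (mul_nonneg hρ0 hρ) hρ, mul_nonneg (mul_nonneg hρ hρ) hρ,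
      mul_nonneg hσ0 hσ0, mul_nonneg hσ0 hσ, mul_nonneg hσ hσ]

/-- **B1, polynomial form.**  For `0 < p_a, p_b ≤ 1`, `s = p_a+p_b`, `P = p_ap_b`, `Q = (1−p_a)(1−p_b)`,
`A₁ = p_a(1−p_b)`, `B₁ = p_b(1−p_a)`:  `s²(sA₁−P)(sB₁−P) ≤ ((sQ+P)(sP+P))²`, i.e. `R(κ_b) ≤ I(κ_b)²` at
`κ_b = P/s` after multiplication by `s⁴` (the identity `((sQ+P)(sP+P))² − s²(sA₁−P)(sB₁−P) = P·s⁵·(1 − (1+s)r(1−r)(2−s+sr))`,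
`r s² = (1+s)P`). [this work] -/
theorem threeLoad_B1_scaled (pa pb : ℝ) (ha : 0 < pa) (hb : 0 < pb) (ha1 : pa ≤ 1) (hb1 : pb ≤ 1) :
    (pa + pb) ^ 2 * ((pa * (1 - pb)) * (pa + pb) - pa * pb) * ((pb * (1 - pa)) * (pa + pb) - pa * pb)
      ≤ (((1 - pa) * (1 - pb) * (pa + pb) + pa * pb) * (pa * pb * (pa + pb) + pa * pb)) ^ 2 := by
  set s := pa + pb with hs
  set P := pa * pb with hP
  have hs0 : 0 < s := by rw [hs]; linarith
  have hP0 : 0 < P := by rw [hP]; exact mul_pos ha hb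
  have hs2 : s ≤ 2 := by rw [hs]; linarith
  have h4 : 4 * P ≤ s ^ 2 := by rw [hs, hP]; nlinarith [sq_nonneg (pa - pb)]
  set r := (1 + s) * P / s ^ 2 with hr
  have hs2pos : 0 < s ^ 2 := by positivity
  have hv : r * s ^ 2 = (1 + s) * P := by rw [hr]; exact div_mul_cancel₀ _ hs2pos.ne'
  have hr0 : 0 ≤ r := by rw [hr]; positivity
  have hr4 : 4 * r ≤ 1 + s := by
    rw [hr, mul_div_assoc', div_le_iff₀ hs2pos]
    nlinarith [h4]
  have hφ := threeLoad_phi_le_one r s hr0 hr4 hs2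
  have key : (((1 - pa) * (1 - pb) * s + P) * (P * s + P)) ^ 2
      - s ^ 2 * ((pa * (1 - pb)) * s - P) * ((pb * (1 - pa)) * s - P)
      = P * (s ^ 5 + (1 + s) * (r * s ^ 2) * ((r * s ^ 2) - s ^ 2) * (2 * s - s ^ 2 + r * s ^ 2)) := by
    rw [hv, hs, hP]; ring
  have key2 : s ^ 5 + (1 + s) * (r * s ^ 2) * ((r * s ^ 2) - s ^ 2) * (2 * s - s ^ 2 + r * s ^ 2)
      = s ^ 5 * (1 - (1 + s) * r * (1 - r) * (2 - s + s * r)) := by ring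
  have hnn : 0 ≤ s ^ 5 * (1 - (1 + s) * r * (1 - r) * (2 - s + s * r)) :=
    mul_nonneg (by positivity) (by linarith)
  have : 0 ≤ (((1 - pa) * (1 - pb) * s + P) * (P * s + P)) ^ 2
      - s ^ 2 * ((pa * (1 - pb)) * s - P) * ((pb * (1 - pa)) * s - P) := by
    rw [key, key2]; exact mul_nonneg hP0.le hnn
  linarith

/-! ### (♣) from APL-G -/

/-- **(♣) from APL-G, rational form, case `p_a ≤ p_b`.**  For `0 < p_a ≤ p_b < 1`, `P = p_ap_b ≤ τ ≤ p_a`, `m ≥ 0` and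
the APL-G inequality at the apex in `(p, τ, m)`-coordinates `((1−p_a−p_b+τ)τ − (p_a+p_b−τ)m)² ≤ (p_a−τ)(p_b−τ)`
(`APL.aplG_all`; see `threeLoad_aplG_pτm`):  with `κ = τ − P`,  `(κ² − κP − 2Pm)·(p_a+p_b)² ≤ P²(1−p_b²)`.
PROOF (memo §6f–§6g made algebraic, no calculus).  Put `s = p_a+p_b`, `c₂ = P²(1−p_b²)/s²`, `m̃(t) = (t²−tP−c₂)/(2P)`,
`κ_b = P/s`.  If `κ ≤ κ_b` then `κ²−κP ≤ c₂` directly.  Otherwise let `C(t) = I(t) − S(t)m̃(t)` with `I(t) = (Q+t)(P+t)`,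
`S(t) = s−P−t`, `R(t) = (A₁−t)(B₁−t)` (so APL-G reads `(I(κ) − S(κ)m)² ≤ R(κ)`): (i) `2P·(C(κ)−C(κ_b)) = (κ−κ_b)·B` with
`B = ⅓[R(κ_b)+4R((κ+κ_b)/2)+R(κ)] + (κ²+κκ_b+κ_b²)/3 + 3P² + σP − c₂ ≥ 0` (Simpson; `κ_b² ≥ c₂`); (ii) `C(κ_b) ≥ I(κ_b) ≥ 0`
(`m̃(κ_b) ≤ 0`); (iii) `R(κ) ≤ R(κ_b) ≤ I(κ_b)²` (`threeLoad_B1_scaled`).  Hence `(I−Sm)² ≤ R(κ) ≤ C(κ)²`, `C(κ) ≥ 0`, so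
`I − Sm ≤ C(κ) = I − S m̃(κ)`, i.e. `m ≥ m̃(κ)`. [this work] -/
theorem threeLoad_clubRat_of_aplG_le (pa pb τ m : ℝ) (ha : 0 < pa) (hab : pa ≤ pb) (hb1 : pb < 1)
    (hH : pa * pb ≤ τ) (hτ : τ ≤ pa) (hm : 0 ≤ m)
    (hapl : ((1 - pa - pb + τ) * τ - (pa + pb - τ) * m) ^ 2 ≤ (pa - τ) * (pb - τ)) :
    ((τ - pa * pb) ^ 2 - (τ - pa * pb) * (pa * pb) - 2 * (pa * pb) * m) * (pa + pb) ^ 2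
      ≤ (pa * pb) ^ 2 * (1 - pb ^ 2) := by
  have hb : 0 < pb := lt_of_lt_of_le ha hab
  have ha1 : pa < 1 := lt_of_le_of_lt hab hb1
  set P := pa * pb with hP
  set s := pa + pb with hs
  set κ := τ - P with hκ
  have hs0 : 0 < s := by rw [hs]; linarith
  have hP0 : 0 < P := by rw [hP]; exact mul_pos ha hb
  have hκ0 : 0 ≤ κ := by rw [hκ]; linarith
  have hκA : κ ≤ pa * (1 - pb) := by rw [hκ, hP]; linarith
  have hAB : pa * (1 - pb) ≤ pb * (1 - pa) := by nlinarith
  have hpbs : pb ≤ s := by rw [hs]; linarith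
  have hs2pos : 0 < s ^ 2 := by positivity
  have hc20 : 0 ≤ P ^ 2 * (1 - pb ^ 2) := by
    have : 0 ≤ 1 - pb ^ 2 := by nlinarith
    positivity
  -- reduce to `κ² − κP − 2Pm ≤ c2`
  set c2 := P ^ 2 * (1 - pb ^ 2) / s ^ 2 with hc2
  have C1 : c2 * s ^ 2 = P ^ 2 * (1 - pb ^ 2) := by rw [hc2]; exact div_mul_cancel₀ _ hs2pos.ne'
  have hc2nn : 0 ≤ c2 := by rw [hc2]; positivity
  suffices hred : κ ^ 2 - κ * P - 2 * P * m ≤ c2 by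
    have := mul_le_mul_of_nonneg_right hred hs2pos.le
    rwa [C1] at this
  set kb := P / s with hkb
  have K1 : kb * s = P := by rw [hkb]; exact div_mul_cancel₀ _ hs0.ne'
  have hkb0 : 0 < kb := by rw [hkb]; exact div_pos hP0 hs0
  rcases le_or_gt κ kb with h1 | h1
  · -- Case 1: `κ ≤ kb = P/s`: then `κ² − κP ≤ c2` and `m ≥ 0`.
    have hks : κ * s ≤ P := by
      have := mul_le_mul_of_nonneg_right h1 hs0.le
      rwa [K1] at this
    have hmain : (κ ^ 2 - κ * P) * s ^ 2 ≤ P ^ 2 * (1 - pb ^ 2) := by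
      rcases le_or_gt κ P with h2 | h2
      · have hneg : κ * (P - κ) * s ^ 2 ≥ 0 :=
          mul_nonneg (mul_nonneg hκ0 (by linarith)) hs2pos.le
        have e : (κ ^ 2 - κ * P) * s ^ 2 = -(κ * (P - κ) * s ^ 2) := by ring
        rw [e]; linarith [hc20]
      · have e1 : (κ * s) ^ 2 ≤ P ^ 2 := pow_le_pow_left₀ (by positivity) hks 2
        have e2a : P * (P * s ^ 2) ≤ P * (κ * s ^ 2) :=
          mul_le_mul_of_nonneg_left (mul_le_mul_of_nonneg_right h2.le hs2pos.le) hP0.le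
        have e2b : pb ^ 2 ≤ s ^ 2 := pow_le_pow_left₀ hb.le hpbs 2
        have e2c : P ^ 2 * pb ^ 2 ≤ P ^ 2 * s ^ 2 := mul_le_mul_of_nonneg_left e2b (sq_nonneg P)
        have e : (κ ^ 2 - κ * P) * s ^ 2 = (κ * s) ^ 2 - P * (κ * s ^ 2) := by ring
        rw [e]
        linarith [e1, e2a, e2c]
    have hpos : 0 ≤ 2 * P * m * s ^ 2 := by positivity
    have e : (κ ^ 2 - κ * P - 2 * P * m) * s ^ 2 = (κ ^ 2 - κ * P) * s ^ 2 - 2 * P * m * s ^ 2 := by ring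
    have : (κ ^ 2 - κ * P - 2 * P * m) * s ^ 2 ≤ c2 * s ^ 2 := by
      rw [e, C1]; linarith [hmain, hpos]
    exact le_of_mul_le_mul_right this hs2pos
  · -- Case 2: `kb < κ ≤ A₁`.
    have hkbA : kb ≤ pa * (1 - pb) := by linarith
    -- scaled quantities
    set q0 := 1 - s + P with hq0
    have hq0nn : 0 ≤ q0 := by
      have : q0 = (1 - pa) * (1 - pb) := by rw [hq0, hs, hP]; ring
      rw [this]; exact mul_nonneg (by linarith) (by linarith)
    set σ := s - 2 * P with hσ
    have hσnn : 0 ≤ σ := by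
      have : σ = pa * (1 - pb) + pb * (1 - pa) := by rw [hσ, hs, hP]; ring
      rw [this]; exact add_nonneg (mul_nonneg ha.le (by linarith)) (mul_nonneg hb.le (by linarith))
    set mk := κ ^ 2 - κ * P - c2 with hmk
    set mb := kb ^ 2 - kb * P - c2 with hmb
    set Ck := 2 * P * ((q0 + κ) * (P + κ)) - (s - P - κ) * mk with hCk
    set Cb := 2 * P * ((q0 + kb) * (P + kb)) - (s - P - kb) * mb with hCb
    clear_value P s κ c2 kb q0 σ mk mb Ck Cb
    -- (F1) monotonicity of the cubic: `Ck ≥ Cb`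
    have hkb2 : c2 ≤ kb ^ 2 := by
      have h' : c2 * s ^ 2 ≤ kb ^ 2 * s ^ 2 := by
        rw [C1, show kb ^ 2 * s ^ 2 = (kb * s) ^ 2 by ring, K1]
        have : 0 ≤ P ^ 2 * pb ^ 2 := by positivity
        linarith only [this]
      exact le_of_mul_le_mul_right h' hs2pos
    have g1 : 0 ≤ (pa * (1 - pb) - kb) * (pb * (1 - pa) - kb) :=
      mul_nonneg (by linarith only [hkbA]) (by linarith only [hkbA, hAB])
    have g2 : 0 ≤ (pa * (1 - pb) - (κ + kb) / 2) * (pb * (1 - pa) - (κ + kb) / 2) :=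
      mul_nonneg (by linarith only [hκA, hkbA]) (by linarith only [hκA, hkbA, hAB])
    have g3 : 0 ≤ (pa * (1 - pb) - κ) * (pb * (1 - pa) - κ) :=
      mul_nonneg (by linarith only [hκA]) (by linarith only [hκA, hAB])
    have hBr : Ck - Cb = (κ - kb) *
        ((1 / 3) * ((pa * (1 - pb) - kb) * (pb * (1 - pa) - kb)
            + 4 * ((pa * (1 - pb) - (κ + kb) / 2) * (pb * (1 - pa) - (κ + kb) / 2))
            + (pa * (1 - pb) - κ) * (pb * (1 - pa) - κ))
          + (κ ^ 2 + κ * kb + kb ^ 2) / 3 + 3 * P ^ 2 + σ * P - c2) := by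
      rw [hCk, hCb, hmk, hmb, hq0, hσ, hs, hP]; ring
    have hsq : kb ^ 2 ≤ (κ ^ 2 + κ * kb + kb ^ 2) / 3 := by
      have t1 : kb * kb ≤ κ * kb := mul_le_mul_of_nonneg_right h1.le hkb0.le
      have t2 : kb * kb ≤ κ * κ := mul_le_mul h1.le h1.le hkb0.le hκ0
      linarith only [t1, t2]
    have hσP : 0 ≤ σ * P := mul_nonneg hσnn hP0.le
    have hBr_nn : 0 ≤ (1 / 3) * ((pa * (1 - pb) - kb) * (pb * (1 - pa) - kb)
            + 4 * ((pa * (1 - pb) - (κ + kb) / 2) * (pb * (1 - pa) - (κ + kb) / 2))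
            + (pa * (1 - pb) - κ) * (pb * (1 - pa) - κ))
          + (κ ^ 2 + κ * kb + kb ^ 2) / 3 + 3 * P ^ 2 + σ * P - c2 := by
      have : 0 ≤ 3 * P ^ 2 := by positivity
      linarith only [g1, g2, g3, hsq, hkb2, hσP, this]
    have F1 : Cb ≤ Ck := by
      have : 0 ≤ Ck - Cb := by rw [hBr]; exact mul_nonneg (by linarith only [h1]) hBr_nn
      linarith only [this]
    -- (F2) `Cb ≥ 2P·I(kb)` since `m̃(kb) ≤ 0`
    have hmb0 : mb ≤ 0 := by
      have h' : mb * s ^ 2 ≤ 0 := by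
        have e : mb * s ^ 2 = (kb * s) ^ 2 - (kb * s) * P * s - c2 * s ^ 2 := by rw [hmb]; ring
        rw [e, K1, C1]
        have e' : P ^ 2 - P * P * s - P ^ 2 * (1 - pb ^ 2) = P ^ 2 * (pb ^ 2 - s) := by ring
        rw [e']
        have hpb2 : pb ^ 2 ≤ pb := by rw [sq]; exact mul_le_of_le_one_right hb.le hb1.le
        have : pb ^ 2 ≤ s := le_trans hpb2 hpbs
        exact mul_nonpos_of_nonneg_of_nonpos (sq_nonneg P) (by linarith only [this])
      by_contra hneg
      push Not at hneg
      have := mul_pos hneg hs2pos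
      linarith only [this, h']
    have hSb : 0 < s - P - kb := by
      have : s - P - pa * (1 - pb) = pb := by rw [hs, hP]; ring
      linarith only [this, hkbA, hb]
    have F2 : 2 * P * ((q0 + kb) * (P + kb)) ≤ Cb := by
      have : 0 ≤ (s - P - kb) * (-mb) := mul_nonneg hSb.le (by linarith only [hmb0])
      have e : Cb = 2 * P * ((q0 + kb) * (P + kb)) + (s - P - kb) * (-mb) := by rw [hCb]; ring
      rw [e]; linarith only [this]
    -- (F3) `I(kb) ≥ 0`
    have F3 : 0 ≤ 2 * P * ((q0 + kb) * (P + kb)) := by positivity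
    -- (F4) `R(κ) ≤ R(kb)`
    have F4 : (pa * (1 - pb) - κ) * (pb * (1 - pa) - κ) ≤ (pa * (1 - pb) - kb) * (pb * (1 - pa) - kb) :=
      mul_le_mul (by linarith only [h1]) (by linarith only [h1]) (by linarith only [hκA, hAB])
        (by linarith only [hkbA])
    -- (F5) B1: `R(kb) ≤ I(kb)²`
    have hB := threeLoad_B1_scaled pa pb ha hb ha1.le hb1.le
    have e1 : (pa + pb) ^ 2 * ((pa * (1 - pb)) * (pa + pb) - pa * pb) * ((pb * (1 - pa)) * (pa + pb) - pa * pb)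
        = s ^ 4 * ((pa * (1 - pb) - kb) * (pb * (1 - pa) - kb)) := by
      rw [← hs, ← hP, ← K1]; ring
    have e2 : (((1 - pa) * (1 - pb) * (pa + pb) + pa * pb) * (pa * pb * (pa + pb) + pa * pb)) ^ 2
        = s ^ 4 * ((q0 + kb) * (P + kb)) ^ 2 := by
      have hq : (1 - pa) * (1 - pb) = q0 := by rw [hq0, hs, hP]; ring
      rw [hq, ← hs, ← hP, ← K1]; ring
    rw [e1, e2] at hB
    have hs4 : 0 < s ^ 4 := by positivity
    have F5 : (pa * (1 - pb) - kb) * (pb * (1 - pa) - kb) ≤ ((q0 + kb) * (P + kb)) ^ 2 :=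
      le_of_mul_le_mul_left hB hs4
    -- (F6) the APL hypothesis in `κ`-coordinates
    have hI : (1 - pa - pb + τ) * τ - (s - τ) * m = (q0 + κ) * (P + κ) - (s - P - κ) * m := by
      rw [hq0, hκ, hs, hP]; ring
    have hR : (pa - τ) * (pb - τ) = (pa * (1 - pb) - κ) * (pb * (1 - pa) - κ) := by
      rw [hκ, hP]; ring
    rw [hI, hR] at hapl
    -- chain of squares
    have hCk0 : 0 ≤ Ck := le_trans F3 (le_trans F2 F1)
    have hP2 : 0 ≤ 4 * P ^ 2 := by positivity
    have chain : (2 * P * ((q0 + κ) * (P + κ) - (s - P - κ) * m)) ^ 2 ≤ Ck ^ 2 := by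
      have s1 : (2 * P * ((q0 + κ) * (P + κ) - (s - P - κ) * m)) ^ 2
          ≤ 4 * P ^ 2 * ((pa * (1 - pb) - kb) * (pb * (1 - pa) - kb)) := by
        have e : (2 * P * ((q0 + κ) * (P + κ) - (s - P - κ) * m)) ^ 2
            = 4 * P ^ 2 * ((q0 + κ) * (P + κ) - (s - P - κ) * m) ^ 2 := by ring
        rw [e]; exact mul_le_mul_of_nonneg_left (hapl.trans F4) hP2
      have s2 : 4 * P ^ 2 * ((pa * (1 - pb) - kb) * (pb * (1 - pa) - kb))
          ≤ (2 * P * ((q0 + kb) * (P + kb))) ^ 2 := by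
        have e : (2 * P * ((q0 + kb) * (P + kb))) ^ 2 = 4 * P ^ 2 * ((q0 + kb) * (P + kb)) ^ 2 := by ring
        rw [e]; exact mul_le_mul_of_nonneg_left F5 hP2
      have s3 : (2 * P * ((q0 + kb) * (P + kb))) ^ 2 ≤ Ck ^ 2 :=
        pow_le_pow_left₀ F3 (le_trans F2 F1) 2
      linarith only [s1, s2, s3]
    have hle : 2 * P * ((q0 + κ) * (P + κ) - (s - P - κ) * m) ≤ Ck := le_of_sq_le_sq chain hCk0
    have hSk : 0 < s - P - κ := by
      have : s - P - pa * (1 - pb) = pb := by rw [hs, hP]; ring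
      linarith only [this, hκA, hb]
    have hmk_le : (s - P - κ) * mk ≤ (s - P - κ) * (2 * P * m) := by
      rw [hCk] at hle
      linarith only [hle]
    have := le_of_mul_le_mul_left hmk_le hSk
    rw [hmk] at this
    linarith only [this]


/-- For `0 < p_a ≤ p_b < 1` and `Ã²(1−p_a²) = p_a²`, `B̃²(1−p_b²) = p_b²`: `(Ã+B̃)²(1−p_b²) ≤ (p_a+p_b)²`. [this work] -/
theorem threeLoad_AtBt_bound (pa pb At Bt : ℝ) (ha : 0 < pa) (hab : pa ≤ pb) (hb1 : pb < 1)
    (hA : At ^ 2 * (1 - pa ^ 2) = pa ^ 2) (hB : Bt ^ 2 * (1 - pb ^ 2) = pb ^ 2) :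
    (At + Bt) ^ 2 * (1 - pb ^ 2) ≤ (pa + pb) ^ 2 := by
  have hb : 0 < pb := lt_of_lt_of_le ha hab
  have h1b : 0 < 1 - pb ^ 2 := by nlinarith
  have hA' : At ^ 2 * (1 - pb ^ 2) ≤ pa ^ 2 := by
    have : 1 - pb ^ 2 ≤ 1 - pa ^ 2 := by nlinarith
    calc At ^ 2 * (1 - pb ^ 2) ≤ At ^ 2 * (1 - pa ^ 2) := mul_le_mul_of_nonneg_left this (sq_nonneg At)
      _ = pa ^ 2 := hA
  have hcross : At * Bt * (1 - pb ^ 2) ≤ pa * pb := by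
    have hsq : (At * Bt * (1 - pb ^ 2)) ^ 2 ≤ (pa * pb) ^ 2 := by
      have e : (At * Bt * (1 - pb ^ 2)) ^ 2 = (At ^ 2 * (1 - pb ^ 2)) * (Bt ^ 2 * (1 - pb ^ 2)) := by ring
      rw [e, hB, mul_pow]
      exact mul_le_mul_of_nonneg_right hA' (sq_nonneg pb)
    exact le_of_sq_le_sq hsq (by positivity)
  have e : (At + Bt) ^ 2 * (1 - pb ^ 2) = At ^ 2 * (1 - pb ^ 2) + 2 * (At * Bt * (1 - pb ^ 2)) + Bt ^ 2 * (1 - pb ^ 2) := by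
    ring
  rw [e, hB]
  nlinarith [hA', hcross]


/-- **(♣) from APL-G, case `p_a ≤ p_b`**, in the form used by `threeLoad_pair_nonpos`: with `Ã²(1−p_a²) = p_a²`,
`B̃²(1−p_b²) = p_b²`, `(κ² − κP − 2Pm)(Ã+B̃)² ≤ P²`. [this work] -/
theorem threeLoad_club_of_aplG_le (pa pb τ m At Bt : ℝ) (ha : 0 < pa) (hab : pa ≤ pb) (hb1 : pb < 1)
    (hH : pa * pb ≤ τ) (hτ : τ ≤ pa) (hm : 0 ≤ m)
    (hapl : ((1 - pa - pb + τ) * τ - (pa + pb - τ) * m) ^ 2 ≤ (pa - τ) * (pb - τ))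
    (hA : At ^ 2 * (1 - pa ^ 2) = pa ^ 2) (hB : Bt ^ 2 * (1 - pb ^ 2) = pb ^ 2) :
    ((τ - pa * pb) ^ 2 - (τ - pa * pb) * (pa * pb) - 2 * (pa * pb) * m) * (At + Bt) ^ 2 ≤ (pa * pb) ^ 2 := by
  have h1 := threeLoad_clubRat_of_aplG_le pa pb τ m ha hab hb1 hH hτ hm hapl
  have h2 := threeLoad_AtBt_bound pa pb At Bt ha hab hb1 hA hB
  set X := (τ - pa * pb) ^ 2 - (τ - pa * pb) * (pa * pb) - 2 * (pa * pb) * m with hX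
  rcases le_or_gt X 0 with hX0 | hX0
  · have : X * (At + Bt) ^ 2 ≤ 0 := mul_nonpos_of_nonpos_of_nonneg hX0 (sq_nonneg _)
    linarith [this, sq_nonneg (pa * pb)]
  · have hb : 0 < pb := lt_of_lt_of_le ha hab
    have h1b : 0 < 1 - pb ^ 2 := by nlinarith
    have t2 : X * (At + Bt) ^ 2 * (1 - pb ^ 2) ≤ (pa * pb) ^ 2 * (1 - pb ^ 2) :=
      calc X * (At + Bt) ^ 2 * (1 - pb ^ 2) = X * ((At + Bt) ^ 2 * (1 - pb ^ 2)) := by ring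
        _ ≤ X * (pa + pb) ^ 2 := mul_le_mul_of_nonneg_left h2 hX0.le
        _ ≤ (pa * pb) ^ 2 * (1 - pb ^ 2) := h1
    exact le_of_mul_le_mul_right t2 h1b

/-- **(♣) from APL-G** (both orders): for `0 < p_a, p_b < 1`, `p_ap_b ≤ τ ≤ min(p_a,p_b)`, `m ≥ 0`, APL-G in
`(p,τ,m)`-coordinates and `Ã²(1−p_a²) = p_a²`, `B̃²(1−p_b²) = p_b²`:  `(κ² − κP − 2Pm)(Ã+B̃)² ≤ P²` (`κ = τ−P`, `P = p_ap_b`).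
This is the hypothesis (♣) of `threeLoad_pair_nonpos` / `threeLoad_vw_of_pairs`. [this work] -/
theorem threeLoad_club_of_aplG (pa pb τ m At Bt : ℝ) (ha : 0 < pa) (ha1 : pa < 1) (hb : 0 < pb) (hb1 : pb < 1)
    (hH : pa * pb ≤ τ) (hτa : τ ≤ pa) (hτb : τ ≤ pb) (hm : 0 ≤ m)
    (hapl : ((1 - pa - pb + τ) * τ - (pa + pb - τ) * m) ^ 2 ≤ (pa - τ) * (pb - τ))
    (hA : At ^ 2 * (1 - pa ^ 2) = pa ^ 2) (hB : Bt ^ 2 * (1 - pb ^ 2) = pb ^ 2) :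
    ((τ - pa * pb) ^ 2 - (τ - pa * pb) * (pa * pb) - 2 * (pa * pb) * m) * (At + Bt) ^ 2 ≤ (pa * pb) ^ 2 := by
  rcases le_total pa pb with hab | hba
  · exact threeLoad_club_of_aplG_le pa pb τ m At Bt ha hab hb1 hH hτa hm hapl hA hB
  · have hapl' : ((1 - pb - pa + τ) * τ - (pb + pa - τ) * m) ^ 2 ≤ (pb - τ) * (pa - τ) := by
      have e1 : (1 - pb - pa + τ) * τ - (pb + pa - τ) * m = (1 - pa - pb + τ) * τ - (pa + pb - τ) * m := by ring
      rw [e1, mul_comm (pb - τ)]; exact hapl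
    have hH' : pb * pa ≤ τ := by rw [mul_comm]; exact hH
    have h := threeLoad_club_of_aplG_le pb pa τ m Bt At hb hba ha1 hH' hτb hm hapl' hB hA
    simpa only [mul_comm pb pa, add_comm Bt At] using h

end APL

end Summit.CriticalPhenomena.PercolationContinuityZ3.Theorems
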